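import Summits.CriticalPhenomena.PercolationContinuityZ3.Theorems.PercNearOneGluingNoHeavyConstsClusterSquareApicesHubs
import HarnessLib

/-!
# CSQ, DUU and TS on an outerplanar graph plus an INDEPENDENT SET OF APICES inside faces (terminals on the rim)

builds on p205010 (kernel theorem, internal audit signed; external expert review pending)

PAPER-2 track "percolation constants", part (ii), seat `prim-consts-1`, gen 20 (lane index
`run/shared/lean/prim/consts/CONSTANTS.md`, row A19; memo `FROM-prim-consts-1-g20-APEX-FACE.md` §0(4)).
Support file for the crux `NoHeavyLowerTail` (stmt-CriticalPhenomena-4575; `--supports`).  Theorems only; no definitions, no sorries.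

THE CLASS (generalising `…ConstsClusterSquareApex.lean` from one apex to any number).  `H` on `Fin n`; a predicate `hub` marks the
APICES; the other (RIM) vertices carry positions `pos u : Fin m`, injective on the rim.  Hypotheses: (I) apices are pairwise
non-adjacent; (R) rim edges pairwise NON-CROSSING in the cyclic order of the positions; (F) no rim edge SEPARATES two neighbours of an
apex; (L) no chord between two neighbours of one apex INTERLEAVES a chord between two neighbours of another apex; (L2) two distinct apices
have at most TWO common neighbours.  ((F), (L), (L2) say that the apices can be drawn inside faces of the outerplanar rim graph without
crossings — two apices in one face see nested or disjoint arcs of it.)  THE RESULT: for rim terminals `a, b, c` no cluster of `a` is doubly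
linked to `{b, c}` (`Consts.Apices.unlinked`), hence CSQ, DUU and TS for every weight vector supported on `H`
(`Consts.clusterSquare_le_sq_of_apices`, `Consts.sq_real_split_le_of_apices`, `Consts.tripleSplit_of_apices`).
Census of the exact combinatorial statement (lane engine g20 `eng/multi_apex.py`, kit j197208): two apices, all (I)(R)(F)(L)(L2) graphs
with ≤ 5 rim vertices (4 288 / 62 944 graphs): 0 violations; dropping (L): 50 violating graphs, dropping (L2): 1 600 (K₂,₃-type); three
apices with 4 rim vertices (19 840 graphs): 0 violations.

THE PROOF.  `…ApicesGap`: two-graph gap lemma, hub contraction over the hub predicate, master lemma (`S`-side graph `Hp S` = rim edges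
+ chords of apices IN `S`; a tested rim step is a `G₀`-edge, a tested hub step through an apex `x ∉ S` is a `C x`-chord).  `…ApicesLinked`:
rim endgame and hub–rim endgame.  `…ApicesHubs`: hub–hub endgame ((L) separates the neighbour pairs of the two clash apices, (L2)
excludes the `K₂,₃` tie, the interval facts from the `K ∪ supp` sets finish).  Here the graphs `G₀`, `Hp S`, `C x` are instantiated by
`SimpleGraph.fromRel` and (R)+(F)+(L) are shown to give all the required non-crossing statements.
References: N. Gladkov, arXiv:2408.08457v2 (2024), Thm. 4.3, Def. 4.2, Lemma 3.1, Thm. 5.2; G. Chartrand, F. Harary,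
Ann. Inst. H. Poincaré B 3 (1967) 433–438.
-/

noncomputable section

open Classical

namespace Summit.CriticalPhenomena.PercolationContinuityZ3.Theorems

open MeasureTheory Finset Literature.Probability.LatticeModels Literature.Probability.Percolation

namespace Consts

namespace Apices

variable {n m : ℕ}

/-- In an `H`-connected `K` (walk form, from a rim vertex `a`) an apex `x ∈ K` has a RIM neighbour inside `K` (apices being pairwise
non-adjacent): the last step of a `K`-walk from `a` to `x`. [folklore] -/
theorem exists_rim_neighbour {H : SimpleGraph (Fin n)} {hub : Fin n → Prop} (hI : ∀ u v, hub u → hub v → ¬ H.Adj u v)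
    {K : Set (Fin n)} {a x : Fin n} (ha : ¬ hub a) (hx : hub x)
    (hW : ∃ W : H.Walk a x, ∀ v ∈ W.support, v ∈ K) : ∃ w, w ∈ K ∧ ¬ hub w ∧ H.Adj x w := by
  obtain ⟨W, hWK⟩ := hW
  cases hWr : W.reverse with
  | nil => exact absurd hx (by cases W with | nil => exact ha | cons h p => exact absurd hWr (by simp))
  | cons hxw W' =>
    rename_i w
    refine ⟨w, hWK w ?_, fun hw => hI x w hx hw hxw, hxw⟩
    have : w ∈ W.reverse.support := by rw [hWr]; simp
    rwa [SimpleGraph.Walk.support_reverse, List.mem_reverse] at this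

/-- **No `H`-connected `K ∋ a` is doubly linked to `{b, c}` when `H` is an outerplanar rim graph plus an independent set of apices inside
faces** (hypotheses (I), (R), (F), (L), (L2) of the module docstring; `a, b, c` on the rim): the hypothesis `hK` of
`Consts.clusterSquare_le_sq_of_unlinked` holds. [folklore: Jordan curve theorem; cf. the planar common-face theorem of Gladkov2024, Thm. 6.1
(connection side, constant 2)] -/
theorem unlinked (H : SimpleGraph (Fin n)) (hub : Fin n → Prop) (pos : Fin n → Fin m)
    (hpos : ∀ u v, ¬ hub u → ¬ hub v → pos u = pos v → u = v)
    (hI : ∀ u v, hub u → hub v → ¬ H.Adj u v)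
    (hR : ∀ p q r s : Fin n, ¬ hub p → ¬ hub q → ¬ hub r → ¬ hub s → H.Adj p q → H.Adj r s →
      pos p < pos r → pos r < pos q → pos q < pos s → False)
    (hF : ∀ x p q u v : Fin n, hub x → ¬ hub p → ¬ hub q → H.Adj p q → H.Adj x u → H.Adj x v →
      pos p < pos u → pos u < pos q → (pos q < pos v ∨ pos v < pos p) → False)
    (hL : ∀ x x' u v u' v' : Fin n, hub x → hub x' → x ≠ x' → H.Adj x u → H.Adj x v → H.Adj x' u' → H.Adj x' v' →
      pos u < pos u' → pos u' < pos v → pos v < pos v' → False)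
    (hL2 : ∀ x x' u v w : Fin n, hub x → hub x' → x ≠ x' → u ≠ v → u ≠ w → v ≠ w →
      H.Adj x u → H.Adj x v → H.Adj x w → H.Adj x' u → H.Adj x' v → H.Adj x' w → False)
    {a b c : Fin n} (ha : ¬ hub a) (hb : ¬ hub b) (hc : ¬ hub c) :
    ∀ (K : Set (Fin n)) (y y' : Fin n), a ∈ K → b ∉ K → c ∉ K →
      (∀ T : Set (Fin n), a ∈ T → (∀ u x, u ∈ T → H.Adj u x → x ∈ K → x ∈ T) → K ⊆ T) →
      y ∉ K → y' ∉ K → (∃ k, k ∈ K ∧ H.Adj k y) → (∃ k, k ∈ K ∧ H.Adj k y') →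
      y ≠ a → y ≠ b → y ≠ c → y' ≠ a → y' ≠ b → y' ≠ c → y ≠ y' →
      (∀ (P₁ : H.Walk y b) (P₂ : H.Walk y' c), (∀ x ∈ P₁.support, x ∉ K) → (∀ x ∈ P₂.support, x ∉ K) →
          ∃ x, x ∈ P₁.support ∧ x ∈ P₂.support) ∨
      (∀ (Q₁ : H.Walk y c) (Q₂ : H.Walk y' b), (∀ x ∈ Q₁.support, x ∉ K) → (∀ x ∈ Q₂.support, x ∉ K) →
          ∃ x, x ∈ Q₁.support ∧ x ∈ Q₂.support) := by
  intro K y y' haK hbK hcK hcl hyK hy'K hky hk'y' _ hyb hyc _ hy'b hy'c hyy'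
  -- the rim graph, the contracted graphs and the chord graphs
  let G₀ : SimpleGraph (Fin n) := SimpleGraph.fromRel fun u v => H.Adj u v ∧ ¬ hub u ∧ ¬ hub v
  let Hp : Set (Fin n) → SimpleGraph (Fin n) := fun S => SimpleGraph.fromRel fun u v =>
    ¬ hub u ∧ ¬ hub v ∧ (H.Adj u v ∨ ∃ x, hub x ∧ x ∈ S ∧ H.Adj x u ∧ H.Adj x v)
  let C : Fin n → SimpleGraph (Fin n) := fun x => SimpleGraph.fromRel fun u v => ¬ hub u ∧ ¬ hub v ∧ H.Adj x u ∧ H.Adj x v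
  have hG₀ : ∀ u v, G₀.Adj u v → H.Adj u v ∧ ¬ hub u ∧ ¬ hub v := by
    intro u v huv
    rcases (SimpleGraph.fromRel_adj _ u v).1 huv with ⟨_, ⟨e, hu, hv⟩ | ⟨e, hv, hu⟩⟩
    · exact ⟨e, hu, hv⟩
    · exact ⟨e.symm, hu, hv⟩
  have hHp : ∀ S u v, (Hp S).Adj u v → ¬ hub u ∧ ¬ hub v ∧ (H.Adj u v ∨ ∃ x, hub x ∧ x ∈ S ∧ H.Adj x u ∧ H.Adj x v) := by
    intro S u v huv
    rcases (SimpleGraph.fromRel_adj _ u v).1 huv with ⟨_, ⟨hu, hv, e⟩ | ⟨hv, hu, e⟩⟩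
    · exact ⟨hu, hv, e⟩
    · rcases e with e | ⟨x, hx, hxS, e1, e2⟩
      · exact ⟨hu, hv, Or.inl e.symm⟩
      · exact ⟨hu, hv, Or.inr ⟨x, hx, hxS, e2, e1⟩⟩
  have hC : ∀ x u v, (C x).Adj u v → ¬ hub u ∧ ¬ hub v ∧ H.Adj x u ∧ H.Adj x v := by
    intro x u v huv
    rcases (SimpleGraph.fromRel_adj _ u v).1 huv with ⟨_, ⟨hu, hv, e1, e2⟩ | ⟨hv, hu, e2, e1⟩⟩
    · exact ⟨hu, hv, e1, e2⟩
    · exact ⟨hu, hv, e1, e2⟩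
  have g1 : ∀ u v, H.Adj u v → ¬ hub u → ¬ hub v → G₀.Adj u v := fun u v e hu hv =>
    (SimpleGraph.fromRel_adj _ u v).2 ⟨e.ne, Or.inl ⟨e, hu, hv⟩⟩
  have g2 : ∀ S u v, H.Adj u v → ¬ hub u → ¬ hub v → (Hp S).Adj u v := fun S u v e hu hv =>
    (SimpleGraph.fromRel_adj _ u v).2 ⟨e.ne, Or.inl ⟨hu, hv, Or.inl e⟩⟩
  have g3 : ∀ (S : Set (Fin n)) x u v, hub x → x ∈ S → u ≠ v → ¬ hub u → ¬ hub v → H.Adj x u → H.Adj x v →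
      (Hp S).Adj u v := fun S x u v hx hxS huv hu hv e1 e2 =>
    (SimpleGraph.fromRel_adj _ u v).2 ⟨huv, Or.inl ⟨hu, hv, Or.inr ⟨x, hx, hxS, e1, e2⟩⟩⟩
  have c1 : ∀ x u v, hub x → u ≠ v → ¬ hub u → ¬ hub v → H.Adj x u → H.Adj x v → (C x).Adj u v :=
    fun x u v _ huv hu hv e1 e2 => (SimpleGraph.fromRel_adj _ u v).2 ⟨huv, Or.inl ⟨hu, hv, e1, e2⟩⟩
  -- no `Hp S`-edge crosses a `G₀`-edge; no `Hp S`-edge crosses a `C x`-chord for `x ∉ S`; no two chords of distinct apices cross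
  have y0 : ∀ (S : Set (Fin n)) p q r s, (Hp S).Adj p q → G₀.Adj r s →
      pos p < pos r → pos r < pos q → pos q < pos s → False := by
    intro S p q r s hpq hrs l1 l2 l3
    obtain ⟨hp, hq, e⟩ := hHp S p q hpq
    obtain ⟨ers, hr, hs⟩ := hG₀ r s hrs
    rcases e with e | ⟨x, hx, -, e1, e2⟩
    · exact hR p q r s hp hq hr hs e ers l1 l2 l3
    · exact hF x r s q p hx hr hs ers e2 e1 l2 l3 (Or.inr l1)
  have y0' : ∀ (S : Set (Fin n)) p q r s, G₀.Adj p q → (Hp S).Adj r s →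
      pos p < pos r → pos r < pos q → pos q < pos s → False := by
    intro S p q r s hpq hrs l1 l2 l3
    obtain ⟨epq, hp, hq⟩ := hG₀ p q hpq
    obtain ⟨hr, hs, e⟩ := hHp S r s hrs
    rcases e with e | ⟨x, hx, -, e1, e2⟩
    · exact hR p q r s hp hq hr hs epq e l1 l2 l3
    · exact hF x p q r s hx hp hq epq e1 e2 l1 l2 (Or.inl l3)
  have yC : ∀ (S : Set (Fin n)) x p q r s, hub x → x ∉ S → (Hp S).Adj p q → (C x).Adj r s →
      pos p < pos r → pos r < pos q → pos q < pos s → False := by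
    intro S x p q r s hx hxS hpq hrs l1 l2 l3
    obtain ⟨hp, hq, e⟩ := hHp S p q hpq
    obtain ⟨_, _, f1, f2⟩ := hC x r s hrs
    rcases e with e | ⟨x', hx', hx'S, e1, e2⟩
    · exact hF x p q r s hx hp hq e f1 f2 l1 l2 (Or.inl l3)
    · exact hL x' x p q r s hx' hx (fun h => hxS (h ▸ hx'S)) e1 e2 f1 f2 l1 l2 l3
  have yC' : ∀ (S : Set (Fin n)) x p q r s, hub x → x ∉ S → (C x).Adj p q → (Hp S).Adj r s →
      pos p < pos r → pos r < pos q → pos q < pos s → False := by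
    intro S x p q r s hx hxS hpq hrs l1 l2 l3
    obtain ⟨_, _, f1, f2⟩ := hC x p q hpq
    obtain ⟨hr, hs, e⟩ := hHp S r s hrs
    rcases e with e | ⟨x', hx', hx'S, e1, e2⟩
    · exact hF x r s q p hx hr hs e f2 f1 l2 l3 (Or.inr l1)
    · exact hL x x' p q r s hx hx' (fun h => hxS (h.symm ▸ hx'S)) f1 f2 e1 e2 l1 l2 l3
  have yCC : ∀ x x' p q r s, hub x → hub x' → x ≠ x' → (C x).Adj p q → (C x').Adj r s →
      pos p < pos r → pos r < pos q → pos q < pos s → False := by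
    intro x x' p q r s hx hx' hxx' hpq hrs l1 l2 l3
    obtain ⟨_, _, e1, e2⟩ := hC x p q hpq
    obtain ⟨_, _, f1, f2⟩ := hC x' r s hrs
    exact hL x x' p q r s hx hx' hxx' e1 e2 f1 f2 l1 l2 l3
  -- cut open at `a`
  have x0 : ∀ (S : Set (Fin n)) p q r s, (Hp S).Adj p q → G₀.Adj r s → (pos p - pos a).val < (pos r - pos a).val →
      (pos r - pos a).val < (pos q - pos a).val → (pos q - pos a).val < (pos s - pos a).val → False :=
    fun S p q r s hpq hrs => Apex.noncross_rot₂ (y0 S) (y0' S) a hpq hrs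
  have x0' : ∀ (S : Set (Fin n)) p q r s, G₀.Adj p q → (Hp S).Adj r s → (pos p - pos a).val < (pos r - pos a).val →
      (pos r - pos a).val < (pos q - pos a).val → (pos q - pos a).val < (pos s - pos a).val → False :=
    fun S p q r s hpq hrs => Apex.noncross_rot₂ (y0' S) (y0 S) a hpq hrs
  have xC : ∀ (S : Set (Fin n)) x p q r s, hub x → x ∉ S → (Hp S).Adj p q → (C x).Adj r s →
      (pos p - pos a).val < (pos r - pos a).val → (pos r - pos a).val < (pos q - pos a).val →
      (pos q - pos a).val < (pos s - pos a).val → False :=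
    fun S x p q r s hx hxS hpq hrs => Apex.noncross_rot₂ (yC S x · · · · hx hxS) (yC' S x · · · · hx hxS) a hpq hrs
  have xC' : ∀ (S : Set (Fin n)) x p q r s, hub x → x ∉ S → (C x).Adj p q → (Hp S).Adj r s →
      (pos p - pos a).val < (pos r - pos a).val → (pos r - pos a).val < (pos q - pos a).val →
      (pos q - pos a).val < (pos s - pos a).val → False :=
    fun S x p q r s hx hxS hpq hrs => Apex.noncross_rot₂ (yC' S x · · · · hx hxS) (yC S x · · · · hx hxS) a hpq hrs
  have xCC : ∀ x x' p q r s, hub x → hub x' → x ≠ x' → (C x).Adj p q → (C x').Adj r s →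
      (pos p - pos a).val < (pos r - pos a).val → (pos r - pos a).val < (pos q - pos a).val →
      (pos q - pos a).val < (pos s - pos a).val → False :=
    fun x x' p q r s hx hx' hxx' hpq hrs =>
      Apex.noncross_rot₂ (yCC x x' · · · · hx hx' hxx') (yCC x' x · · · · hx' hx hxx'.symm) a hpq hrs
  obtain ⟨k, hkK, hky⟩ := hky
  obtain ⟨k', hk'K, hk'y'⟩ := hk'y'
  by_contra hcon
  push Not at hcon
  obtain ⟨⟨P₁, P₂, hP₁, hP₂, hPd⟩, ⟨Q₁, Q₂, hQ₁, hQ₂, hQd⟩⟩ := hcon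
  have hKw := NonCrossing.walks_of_closure haK hcl
  have hbc : b ≠ c := fun e => hPd b P₁.end_mem_support (e ▸ P₂.end_mem_support)
  -- an `Hp K`-edge from the rim part of `K` to a rim clash vertex
  have link : ∀ {z kz : Fin n}, ¬ hub z → z ∉ K → kz ∈ K → H.Adj kz z → ∃ k'', k'' ∈ K ∧ ¬ hub k'' ∧ (Hp K).Adj k'' z := by
    intro z kz hz hzK hkzK hkz
    by_cases hkh : hub kz
    · obtain ⟨w, hwK, hw, hxw⟩ := exists_rim_neighbour hI ha hkh (hKw kz hkzK)
      exact ⟨w, hwK, hw, g3 K kz w z hkh hkzK (fun e => hzK (e ▸ hwK)) hw hz hxw hkz⟩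
    · exact ⟨kz, hkzK, hkh, g2 K kz z hkz hkh hz⟩
  by_cases hyh : hub y
  · by_cases hy'h : hub y'
    · exact false_of_linked_hubs hpos hI g1 g2 g3 c1 x0 x0' xC xC' xCC ha hL2 hKw hyh hy'h hyy' hyK hb hc hbc
        hkK (fun e => hI y k hyh e hky.symm) hky.symm hk'K (fun e => hI y' k' hy'h e hk'y'.symm) hk'y'.symm
        P₁ P₂ hP₁ hP₂ hPd Q₁ Q₂ hQ₁ hQ₂ hQd
    · obtain ⟨k'', hk''K, hk''h, hk''z⟩ := link hy'h hy'K hk'K hk'y'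
      exact false_of_linked_hub hpos hI g1 g2 g3 c1 x0 x0' xC xC' ha hKw hyh hyK hb hc hy'h hkK hky hk'K hk'y' hk''K hk''h hk''z
        hy'b hy'c hbc P₁ P₂ hP₁ hP₂ hPd Q₁ Q₂ hQ₁ hQ₂ hQd
  · by_cases hy'h : hub y'
    · obtain ⟨k'', hk''K, hk''h, hk''z⟩ := link hyh hyK hkK hky
      exact false_of_linked_hub hpos hI g1 g2 g3 c1 x0 x0' xC xC' ha hKw hy'h hy'K hc hb hyh hk'K hk'y' hkK hky hk''K hk''h hk''z
        hyc hyb hbc.symm P₂ P₁ hP₂ hP₁ (fun x hx hx' => hPd x hx' hx) Q₂ Q₁ hQ₂ hQ₁ (fun x hx hx' => hQd x hx' hx)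
    · exact false_of_linked_rim hpos hI g1 g2 g3 c1 x0 x0' xC xC' ha hKw hb hc hyh hy'h hkK hky hk'K hk'y' hyb hyc hy'b hy'c
        hyy' hbc P₁ P₂ hP₁ hP₂ hPd Q₁ Q₂ hQ₁ hQ₂ hQd

end Apices

/-! ### CSQ, DUU, TS -/

section Fin

variable {n m : ℕ} (w : Sym2 (Fin n) → unitInterval) (a b c : Fin n) (H : SimpleGraph (Fin n)) (hub : Fin n → Prop)
  (pos : Fin n → Fin m)

/-- **CSQ for an outerplanar rim graph plus independent apices inside faces, terminals on the rim** (hypotheses (I), (R), (F), (L), (L2)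
as in `Consts.Apices.unlinked`; `H ⊇` positive pairs of `w`): `clusterSquare w a b c ≤ μ(b ↮ c)²`.
[cite: Gladkov2024, Thm. 4.3, Def. 4.2, Lemma 3.1, Thm. 5.2] -/
theorem clusterSquare_le_sq_of_apices (hH : ∀ u v, u ≠ v → (0 : ℝ) < w s(u, v) → H.Adj u v)
    (hpos : ∀ u v, ¬ hub u → ¬ hub v → pos u = pos v → u = v) (hI : ∀ u v, hub u → hub v → ¬ H.Adj u v)
    (hR : ∀ p q r s : Fin n, ¬ hub p → ¬ hub q → ¬ hub r → ¬ hub s → H.Adj p q → H.Adj r s →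
      pos p < pos r → pos r < pos q → pos q < pos s → False)
    (hF : ∀ x p q u v : Fin n, hub x → ¬ hub p → ¬ hub q → H.Adj p q → H.Adj x u → H.Adj x v →
      pos p < pos u → pos u < pos q → (pos q < pos v ∨ pos v < pos p) → False)
    (hL : ∀ x x' u v u' v' : Fin n, hub x → hub x' → x ≠ x' → H.Adj x u → H.Adj x v → H.Adj x' u' → H.Adj x' v' →
      pos u < pos u' → pos u' < pos v → pos v < pos v' → False)
    (hL2 : ∀ x x' u v t : Fin n, hub x → hub x' → x ≠ x' → u ≠ v → u ≠ t → v ≠ t →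
      H.Adj x u → H.Adj x v → H.Adj x t → H.Adj x' u → H.Adj x' v → H.Adj x' t → False)
    (ha : ¬ hub a) (hb : ¬ hub b) (hc : ¬ hub c) :
    clusterSquare w a b c ≤ (prodBernoulli w).real (openConn b c)ᶜ ^ 2 :=
  clusterSquare_le_sq_of_unlinked w a b c H hH (Apices.unlinked H hub pos hpos hI hR hF hL hL2 ha hb hc)

/-- **DUU for an outerplanar rim graph plus independent apices inside faces, rim root and terminals**:
`μ(a↮b, a↮c, b↮c)² ≤ μ(a↮b, a↮c) · μ(b↮c)²`. [cite: Gladkov2024, Thm. 5.2 and Thm. 4.3] -/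
theorem sq_real_split_le_of_apices (hH : ∀ u v, u ≠ v → (0 : ℝ) < w s(u, v) → H.Adj u v)
    (hpos : ∀ u v, ¬ hub u → ¬ hub v → pos u = pos v → u = v) (hI : ∀ u v, hub u → hub v → ¬ H.Adj u v)
    (hR : ∀ p q r s : Fin n, ¬ hub p → ¬ hub q → ¬ hub r → ¬ hub s → H.Adj p q → H.Adj r s →
      pos p < pos r → pos r < pos q → pos q < pos s → False)
    (hF : ∀ x p q u v : Fin n, hub x → ¬ hub p → ¬ hub q → H.Adj p q → H.Adj x u → H.Adj x v →
      pos p < pos u → pos u < pos q → (pos q < pos v ∨ pos v < pos p) → False)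
    (hL : ∀ x x' u v u' v' : Fin n, hub x → hub x' → x ≠ x' → H.Adj x u → H.Adj x v → H.Adj x' u' → H.Adj x' v' →
      pos u < pos u' → pos u' < pos v → pos v < pos v' → False)
    (hL2 : ∀ x x' u v t : Fin n, hub x → hub x' → x ≠ x' → u ≠ v → u ≠ t → v ≠ t →
      H.Adj x u → H.Adj x v → H.Adj x t → H.Adj x' u → H.Adj x' v → H.Adj x' t → False)
    (ha : ¬ hub a) (hb : ¬ hub b) (hc : ¬ hub c) :
    (prodBernoulli w).real ((openConn a b)ᶜ ∩ (openConn a c)ᶜ ∩ (openConn b c)ᶜ) ^ 2 ≤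
      (prodBernoulli w).real ((openConn a b)ᶜ ∩ (openConn a c)ᶜ) * (prodBernoulli w).real (openConn b c)ᶜ ^ 2 :=
  sq_real_split_le_of_unlinked w a b c H hH (Apices.unlinked H hub pos hpos hI hR hF hL hL2 ha hb hc)

/-- **TS for an outerplanar rim graph plus independent apices inside faces, rim terminals**:
`μ(a↮b, a↮c, b↮c)² ≤ μ(a↮b) · μ(a↮c) · μ(b↮c)`. [cite: Gladkov2024, Thm. 5.2, Cor. 5.3 (pattern) and Thm. 4.3] -/
theorem tripleSplit_of_apices (hH : ∀ u v, u ≠ v → (0 : ℝ) < w s(u, v) → H.Adj u v)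
    (hpos : ∀ u v, ¬ hub u → ¬ hub v → pos u = pos v → u = v) (hI : ∀ u v, hub u → hub v → ¬ H.Adj u v)
    (hR : ∀ p q r s : Fin n, ¬ hub p → ¬ hub q → ¬ hub r → ¬ hub s → H.Adj p q → H.Adj r s →
      pos p < pos r → pos r < pos q → pos q < pos s → False)
    (hF : ∀ x p q u v : Fin n, hub x → ¬ hub p → ¬ hub q → H.Adj p q → H.Adj x u → H.Adj x v →
      pos p < pos u → pos u < pos q → (pos q < pos v ∨ pos v < pos p) → False)
    (hL : ∀ x x' u v u' v' : Fin n, hub x → hub x' → x ≠ x' → H.Adj x u → H.Adj x v → H.Adj x' u' → H.Adj x' v' →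
      pos u < pos u' → pos u' < pos v → pos v < pos v' → False)
    (hL2 : ∀ x x' u v t : Fin n, hub x → hub x' → x ≠ x' → u ≠ v → u ≠ t → v ≠ t →
      H.Adj x u → H.Adj x v → H.Adj x t → H.Adj x' u → H.Adj x' v → H.Adj x' t → False)
    (ha : ¬ hub a) (hb : ¬ hub b) (hc : ¬ hub c) :
    (prodBernoulli w).real ((openConn a b)ᶜ ∩ (openConn a c)ᶜ ∩ (openConn b c)ᶜ) ^ 2 ≤
      (prodBernoulli w).real (openConn a b)ᶜ * (prodBernoulli w).real (openConn a c)ᶜ *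
        (prodBernoulli w).real (openConn b c)ᶜ :=
  tripleSplit_of_unlinked w a b c H hH (Apices.unlinked H hub pos hpos hI hR hF hL hL2 ha hb hc)

end Fin

/-! ### Concrete form: vertices `Fin (N + M)`, rim `Fin.castAdd M i` (natural cyclic order), apices `Fin.natAdd N j` -/

/-- **TS for the weighted "polygon with chords plus `M` interior vertices" graphs on `Fin (N + M)`**: rim vertices `Fin.castAdd M i`
(`i : Fin N`) in their natural cyclic order, apices = the last `M` vertices; `w` any weight vector with (I) no positive apex–apex pair,
(R) positive rim–rim pairs non-crossing, (F) none of them separating two rim vertices positively joined to one apex, (L) no two apices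
with interleaving positive neighbour pairs, (L2) no two apices with three common positive neighbours.  Then for all rim terminals
`a, b, c`: `μ(a↮b, a↮c, b↮c)² ≤ μ(a↮b) μ(a↮c) μ(b↮c)`. [cite: Gladkov2024, Thm. 5.2, Cor. 5.3 (pattern) and Thm. 4.3] -/
theorem tripleSplit_apices (N M : ℕ) (w : Sym2 (Fin (N + M)) → unitInterval)
    (hI : ∀ x x' : Fin (N + M), N ≤ x.val → N ≤ x'.val → ¬ (0 : ℝ) < w s(x, x'))
    (hR : ∀ p q r s : Fin N, (0 : ℝ) < w s(Fin.castAdd M p, Fin.castAdd M q) → (0 : ℝ) < w s(Fin.castAdd M r, Fin.castAdd M s) →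
      p < r → r < q → q < s → False)
    (hF : ∀ x : Fin (N + M), N ≤ x.val → ∀ p q u v : Fin N, (0 : ℝ) < w s(Fin.castAdd M p, Fin.castAdd M q) →
      (0 : ℝ) < w s(x, Fin.castAdd M u) → (0 : ℝ) < w s(x, Fin.castAdd M v) → p < u → u < q → (q < v ∨ v < p) → False)
    (hL : ∀ x x' : Fin (N + M), N ≤ x.val → N ≤ x'.val → x ≠ x' → ∀ u v u' v' : Fin N, (0 : ℝ) < w s(x, Fin.castAdd M u) →
      (0 : ℝ) < w s(x, Fin.castAdd M v) → (0 : ℝ) < w s(x', Fin.castAdd M u') → (0 : ℝ) < w s(x', Fin.castAdd M v') →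
      u < u' → u' < v → v < v' → False)
    (hL2 : ∀ x x' : Fin (N + M), N ≤ x.val → N ≤ x'.val → x ≠ x' → ∀ u v t : Fin N, u ≠ v → u ≠ t → v ≠ t →
      (0 : ℝ) < w s(x, Fin.castAdd M u) → (0 : ℝ) < w s(x, Fin.castAdd M v) → (0 : ℝ) < w s(x, Fin.castAdd M t) →
      (0 : ℝ) < w s(x', Fin.castAdd M u) → (0 : ℝ) < w s(x', Fin.castAdd M v) → (0 : ℝ) < w s(x', Fin.castAdd M t) → False)
    (a b c : Fin N) :
    (prodBernoulli w).real ((openConn (Fin.castAdd M a) (Fin.castAdd M b))ᶜ ∩ (openConn (Fin.castAdd M a) (Fin.castAdd M c))ᶜ ∩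
        (openConn (Fin.castAdd M b) (Fin.castAdd M c))ᶜ) ^ 2 ≤
      (prodBernoulli w).real (openConn (Fin.castAdd M a) (Fin.castAdd M b))ᶜ *
        (prodBernoulli w).real (openConn (Fin.castAdd M a) (Fin.castAdd M c))ᶜ *
        (prodBernoulli w).real (openConn (Fin.castAdd M b) (Fin.castAdd M c))ᶜ := by
  let H : SimpleGraph (Fin (N + M)) := SimpleGraph.fromRel fun u v => (0 : ℝ) < w s(u, v)
  have hH : ∀ u v, u ≠ v → (0 : ℝ) < w s(u, v) → H.Adj u v := fun u v huv hw =>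
    (SimpleGraph.fromRel_adj _ u v).2 ⟨huv, Or.inl hw⟩
  have hH' : ∀ u v, H.Adj u v → (0 : ℝ) < w s(u, v) := by
    intro u v huv
    rcases (SimpleGraph.fromRel_adj _ u v).1 huv with ⟨_, e | e⟩
    · exact e
    · rwa [Sym2.eq_swap] at e
  -- every rim vertex is a `castAdd`
  have hcast : ∀ u : Fin (N + M), ¬ N ≤ u.val → ∃ i : Fin N, u = Fin.castAdd M i := fun u hu =>
    ⟨⟨u.val, by omega⟩, Fin.ext (by simp)⟩
  have hlt : ∀ p r : Fin N, Fin.castAdd M p < Fin.castAdd M r → p < r := fun p r h => by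
    rw [Fin.lt_def] at h ⊢; simpa using h
  have hrim : ∀ i : Fin N, ¬ N ≤ (Fin.castAdd M i).val := fun i => by simp
  refine tripleSplit_of_apices w (Fin.castAdd M a) (Fin.castAdd M b) (Fin.castAdd M c) H (fun v => N ≤ v.val) id hH
    (fun u v _ _ e => e) (fun u v hu hv e => hI u v hu hv (hH' u v e)) ?_ ?_ ?_ ?_ (hrim a) (hrim b) (hrim c)
  · intro p q r s hp hq hr hs hpq hrs l1 l2 l3
    obtain ⟨p, rfl⟩ := hcast p hp; obtain ⟨q, rfl⟩ := hcast q hq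
    obtain ⟨r, rfl⟩ := hcast r hr; obtain ⟨s, rfl⟩ := hcast s hs
    exact hR p q r s (hH' _ _ hpq) (hH' _ _ hrs) (hlt _ _ l1) (hlt _ _ l2) (hlt _ _ l3)
  · intro x p q u v hx hp hq hpq hu hv l1 l2 l3
    obtain ⟨p, rfl⟩ := hcast p hp; obtain ⟨q, rfl⟩ := hcast q hq
    obtain ⟨u, rfl⟩ := hcast u (fun h => hI x _ hx h (hH' _ _ hu))
    obtain ⟨v, rfl⟩ := hcast v (fun h => hI x _ hx h (hH' _ _ hv))
    refine hF x hx p q u v (hH' _ _ hpq) (hH' _ _ hu) (hH' _ _ hv) (hlt _ _ l1) (hlt _ _ l2) ?_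
    rcases l3 with l3 | l3
    · exact Or.inl (hlt _ _ l3)
    · exact Or.inr (hlt _ _ l3)
  · intro x x' u v u' v' hx hx' hxx' hu hv hu' hv' l1 l2 l3
    obtain ⟨u, rfl⟩ := hcast u (fun h => hI x _ hx h (hH' _ _ hu))
    obtain ⟨v, rfl⟩ := hcast v (fun h => hI x _ hx h (hH' _ _ hv))
    obtain ⟨u', rfl⟩ := hcast u' (fun h => hI x' _ hx' h (hH' _ _ hu'))
    obtain ⟨v', rfl⟩ := hcast v' (fun h => hI x' _ hx' h (hH' _ _ hv'))
    exact hL x x' hx hx' hxx' u v u' v' (hH' _ _ hu) (hH' _ _ hv) (hH' _ _ hu') (hH' _ _ hv') (hlt _ _ l1) (hlt _ _ l2)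
      (hlt _ _ l3)
  · intro x x' u v t hx hx' hxx' huv hut hvt hu hv ht hu' hv' ht'
    obtain ⟨u, rfl⟩ := hcast u (fun h => hI x _ hx h (hH' _ _ hu))
    obtain ⟨v, rfl⟩ := hcast v (fun h => hI x _ hx h (hH' _ _ hv))
    obtain ⟨t, rfl⟩ := hcast t (fun h => hI x _ hx h (hH' _ _ ht))
    exact hL2 x x' hx hx' hxx' u v t (fun e => huv (e ▸ rfl)) (fun e => hut (e ▸ rfl)) (fun e => hvt (e ▸ rfl))
      (hH' _ _ hu) (hH' _ _ hv) (hH' _ _ ht) (hH' _ _ hu') (hH' _ _ hv') (hH' _ _ ht')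

end Consts

end Summit.CriticalPhenomena.PercolationContinuityZ3.Theorems
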